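import Summits.CriticalPhenomena.PercolationContinuityZ3.Theorems.Transplant.FKThreeApexWord
import Summits.CriticalPhenomena.PercolationContinuityZ3.Theorems.Transplant.FKThreeApexPinned
import Summits.CriticalPhenomena.PercolationContinuityZ3.Theorems.Transplant.FKConnectivityAllQWheelNegCorr
import Summits.CriticalPhenomena.PercolationContinuityZ3.Theorems.Transplant.FKConnectivityAllQDegThree
import HarnessLib

/-!
# Connectivity correlation inequalities for `φ_{w,q}`, `0 < q ≤ 1` — the three-apex family: the TWO EDGES AT A LEAF of `K_{3,n}` are
# negatively correlated, for every `n` and all weights (type T1; measure assembly)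

Support file (`--supports stmt-CriticalPhenomena-4575`), FK sub-lane `prim-bschramm-fk-3` (gen 13); builds on p205010 (kernel theorem, internal audit
signed; external expert review pending).  No named facts, no sorries; standard axioms.  Layer 3b of the `K_{1,1,1,n}` programme (memo
`bschramm/prim-bschramm-fk-3/THREE-APEX.md` §6): the first MEASURE-LEVEL theorem of the family.

Setting (as in `…ThreeApexWord`): a finite vertex type `V` with `card V = n + 3`, three distinct apices `a, b, c`, pairwise distinct leaves
`v 0, …, v (n-1)` (none an apex), a weight vector `w : Sym2 V → [0,1]` supported on the apex–leaf pairs (the weighted graph `K_{3,n}`, ARBITRARY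
parameters in `[0,1]` on its `3n` edges), and `0 < q ≤ 1`.  **`negCorr_leaf`**: for every leaf `u = v j₀` and two distinct apices `x, y`,
`φ_{w,q}(J_{xu} ∩ J_{yu}) ≤ φ_{w,q}(J_{xu})·φ_{w,q}(J_{yu})`  (`J_e = {ω | e ∈ ω}`); packaged as `NegCorrPairSupp` slices (`negCorrPairSupp_leaf`).
For `n ≥ 3` these are pairs of a 3-connected graph (`K_{3,3} ⊆ K_{3,n}`) outside the series–parallel/`K₄`/wheel/`≤ 5`-vertex stock.

PROOF (kernel; every identity is `ring`).  (1) `(V5, conv, δ_0)` is a commutative monoid (`conv_comm`, `…Pinned`), so the letter product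
`zvec` of the transfer formula `Z_w = val_q(zvec)` (`rcPartitionFunctionW_eq_transfer3`, `…Word`) is a `Finset.prod` (`zvec_eq_prod`) and the
marked leaf can be pulled to the front: for the weight vector re-pinned to `σ, τ` on `s(a, v j₀), s(b, v j₀)`,
`Z = val_q(leaf q σ τ c₀ · R)` with `c₀ = w(c, v j₀)` and `R` the product of the other leaf letters (`transfer3_pin_leaf`), `R ∈ InK q`
(`inK_prod`).  (2) The masses `S(J_e) = w_e Z_{w[e↦1]}`, `S(J_e ∩ J_f) = w_e w_f Z_{w[e,f↦1]}` (`Wheel.sum_openPair_*`) and bi-affinity of the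
leaf letter turn `S(J_e)S(J_f) − S(J_e ∩ J_f)Z` into `w_e w_f (1−w_e)(1−w_f)·(Z¹⁰Z⁰¹ − Z¹¹Z⁰⁰) = w_e w_f(1−w_e)(1−w_f)·t1Form q c₀ R`
(`rayleigh_T1_eq`), which is `≥ 0` by `InK.t1Form_nonneg` (`…Algebra`: `t1Form = q²(1−q)c₀²·N^{(ab)} +` a non-negative form, and the MASTER
inequality `N ≥ 0` on the monoid).  The other apex pairs follow by relabelling the apices (`apexPairs_swap₂₃`, `apexPairs_rotate`).
[cite: Grimmett2006, §1.4 eq. (1.20) (p. 15); §3.9 eq. (3.94), Conj. (3.96) (pp. 63–66)] [cite: Wagner2006, Thm. 5.8, §5.3 (pp. 14–15)]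
-/

noncomputable section

namespace Summit.CriticalPhenomena.PercolationContinuityZ3.Theorems

namespace FK

namespace ThreeApex

open Literature.Probability.LatticeModels Literature.Probability.Percolation
open Literature.Probability.Percolation.DecisionTree (ind ind_of_mem ind_of_not_mem ind_nonneg)
open scoped Classical

/-! ### The commutative monoid of five-vectors -/

/-- `(V5, conv, δ_0)` is a commutative monoid: the monoid algebra of the join-semilattice `Π₃` restricted to fibre-mass vectors. [folklore] -/
instance instCommMonoidV5 : CommMonoid V5 where
  mul := conv
  one := delta0
  mul_assoc x y z := by
    show conv (conv x y) z = conv x (conv y z)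
    ext <;> simp only [conv, V5.total] <;> ring
  one_mul x := by
    show conv delta0 x = x
    ext <;> simp [conv, delta0, V5.total]
  mul_one x := by
    show conv x delta0 = x
    ext <;> simp [conv, delta0, V5.total]
  mul_comm x y := by
    show conv x y = conv y x
    ext <;> simp only [conv, V5.total] <;> ring

/-- Multiplication is the letter action. [folklore] -/
theorem mul_def (z Z : V5) : z * Z = conv z Z := rfl

/-- The unit is `δ_0`. [folklore] -/
theorem one_def : (1 : V5) = delta0 := rfl

/-- The monoid is closed under products. [folklore] -/
theorem InK.mul {q : ℝ} {Z Z' : V5} (h : InK q Z) (h' : InK q Z') : InK q (Z * Z') := by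
  induction h with
  | base => rw [← one_def, one_mul]; exact h'
  | @step z Z₀ hz _ ih => rw [← mul_def, mul_assoc, mul_def]; exact InK.step hz ih

/-- A letter is in the monoid. [folklore] -/
theorem IsLetter.inK {q : ℝ} {z : V5} (hz : IsLetter q z) : InK q z := by
  have h := InK.step hz InK.base
  rwa [← mul_def, ← one_def, mul_one] at h

/-- A finite product of letters is in the monoid. [folklore] -/
theorem inK_prod {q : ℝ} {ι : Type*} (s : Finset ι) (f : ι → V5) (hf : ∀ i ∈ s, IsLetter q (f i)) : InK q (∏ i ∈ s, f i) :=
  Finset.prod_induction f (InK q) (fun _ _ hx hy => hx.mul hy) (by rw [one_def]; exact InK.base) fun i hi => (hf i hi).inK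

variable {V : Type*} [Fintype V]

omit [Fintype V] in
/-- The letter read off a weight vector is an admissible letter (weights lie in `[0,1]`). [folklore] -/
theorem isLetter_leafOf (q : ℝ) (w : Sym2 V → unitInterval) (a b c u : V) : IsLetter q (leafOf q w a b c u) :=
  IsLetter.leaf (w _).2.1 (w _).2.2 (w _).2.1 (w _).2.2 (w _).2.1 (w _).2.2

omit [Fintype V] in
/-- **The letter product is a `Finset.prod`.** [folklore] -/
theorem zvec_eq_prod (q : ℝ) (w : Sym2 V → unitInterval) (a b c : V) (v : ℕ → V) (n : ℕ) :
    zvec q w a b c v n = ∏ j ∈ Finset.range n, leafOf q w a b c (v j) := by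
  induction n with
  | zero => rw [Finset.prod_range_zero, one_def]; rfl
  | succ n ih => rw [zvec, Finset.prod_range_succ, ← ih, mul_comm, mul_def]

omit [Fintype V] in
/-- The letter product lies in the monoid. [folklore] -/
theorem inK_zvec (q : ℝ) (w : Sym2 V → unitInterval) (a b c : V) (v : ℕ → V) (n : ℕ) : InK q (zvec q w a b c v n) := by
  rw [zvec_eq_prod]; exact inK_prod _ _ fun j _ => isLetter_leafOf q w a b c (v j)

/-! ### Bi-affinity of the pinned valuations -/

/-- The valuation of `leaf q s t c · R` is bi-affine in the two pinned probabilities `s, t`. [folklore] -/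
theorem val_leaf_mul_biaffine (q s t c : ℝ) (R : V5) :
    val q (leaf q s t c * R) = (1 - s) * (1 - t) * val q (leaf q 0 0 c * R) + s * (1 - t) * val q (leaf q 1 0 c * R)
      + (1 - s) * t * val q (leaf q 0 1 c * R) + s * t * val q (leaf q 1 1 c * R) := by
  simp only [mul_def, val, conv, leaf, V5.total]; ring

/-- **The Rayleigh identity in probabilities**: `(s·Z[1,t])(t·Z[s,1]) − (st·Z[1,1])·Z[s,t] = st(1−s)(1−t)·(Z¹⁰Z⁰¹ − Z¹¹Z⁰⁰) = st(1−s)(1−t)·t1Form`.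
[folklore] -/
theorem rayleigh_T1_prob (q s t c : ℝ) (R : V5) :
    (s * val q (leaf q 1 t c * R)) * (t * val q (leaf q s 1 c * R)) - (s * t * val q (leaf q 1 1 c * R)) * val q (leaf q s t c * R) =
      s * t * ((1 - s) * (1 - t)) * t1Form q c R := by
  rw [← rayleigh_T1_eq, val_leaf_mul_biaffine q 1 t c, val_leaf_mul_biaffine q s 1 c, val_leaf_mul_biaffine q s t c]
  simp only [mul_def]
  ring

/-! ### Relabelling the apices -/

omit [Fintype V] in
/-- `apexPairs` is symmetric in the last two apices. [folklore] -/
theorem apexPairs_swap₂₃ (a b c : V) (v : ℕ → V) (n : ℕ) : apexPairs a c b v n = apexPairs a b c v n := by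
  ext e
  simp only [mem_apexPairs_iff]
  constructor
  · rintro ⟨j, hj, h | h | h⟩
    · exact ⟨j, hj, Or.inl h⟩
    · exact ⟨j, hj, Or.inr (Or.inr h)⟩
    · exact ⟨j, hj, Or.inr (Or.inl h)⟩
  · rintro ⟨j, hj, h | h | h⟩
    · exact ⟨j, hj, Or.inl h⟩
    · exact ⟨j, hj, Or.inr (Or.inr h)⟩
    · exact ⟨j, hj, Or.inr (Or.inl h)⟩

omit [Fintype V] in
/-- `apexPairs` is invariant under rotating the apices. [folklore] -/
theorem apexPairs_rotate (a b c : V) (v : ℕ → V) (n : ℕ) : apexPairs b c a v n = apexPairs a b c v n := by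
  ext e
  simp only [mem_apexPairs_iff]
  constructor
  · rintro ⟨j, hj, h | h | h⟩
    · exact ⟨j, hj, Or.inr (Or.inl h)⟩
    · exact ⟨j, hj, Or.inr (Or.inr h)⟩
    · exact ⟨j, hj, Or.inl h⟩
  · rintro ⟨j, hj, h | h | h⟩
    · exact ⟨j, hj, Or.inr (Or.inr h)⟩
    · exact ⟨j, hj, Or.inl h⟩
    · exact ⟨j, hj, Or.inr (Or.inl h)⟩

/-! ### The pinned partition functions -/

section Setting

variable {a b c : V} {v : ℕ → V} {n : ℕ}
variable (hab : a ≠ b) (hac : a ≠ c) (hbc : b ≠ c) (hinj : ∀ j k, j < n → k < n → v j = v k → j = k)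
  (hva : ∀ j, j < n → v j ≠ a) (hvb : ∀ j, j < n → v j ≠ b) (hvc : ∀ j, j < n → v j ≠ c)
include hab hac hbc hinj hva hvb hvc

omit [Fintype V] hab hac hbc hinj hva hvb hvc in
/-- Re-pinning apex–leaf pairs keeps the support inside `apexPairs`. [folklore] -/
theorem supp_update_apexPair (w : Sym2 V → unitInterval) (hsupp : ∀ e, e ∉ apexPairs a b c v n → w e = 0) {e : Sym2 V}
    (he : e ∈ apexPairs a b c v n) (σ : unitInterval) : ∀ g, g ∉ apexPairs a b c v n → Function.update w e σ g = 0 := by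
  intro g hg
  have hne : g ≠ e := fun h => hg (h ▸ he)
  rw [Function.update_of_ne hne]
  exact hsupp g hg

omit [Fintype V] hab hac hbc hinj hva hvb hvc in
/-- The pairs `s(a, v j)`, `s(b, v j)` are apex pairs. [folklore] -/
theorem mem_apexPairs_ab {j : ℕ} (hj : j < n) : s(a, v j) ∈ apexPairs a b c v n ∧ s(b, v j) ∈ apexPairs a b c v n :=
  ⟨(mem_apexPairs_iff _).2 ⟨j, hj, Or.inl rfl⟩, (mem_apexPairs_iff _).2 ⟨j, hj, Or.inr (Or.inl rfl)⟩⟩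

omit [Fintype V] in
/-- **Pulling the marked leaf to the front.**  For the weight vector re-pinned to `σ, τ` on the pairs `s(a, v j₀)`, `s(b, v j₀)` the transfer
expression is `val_q(leaf q σ τ c₀ · R)`, `c₀ = w(c, v j₀)`, `R` = the product of the other leaf letters (independent of `σ, τ`). [folklore] -/
theorem transfer3_pin_leaf (q : ℝ) (w : Sym2 V → unitInterval) {j₀ : ℕ} (hj₀ : j₀ < n) (σ τ : unitInterval) :
    transfer3 q (Function.update (Function.update w s(a, v j₀) σ) s(b, v j₀) τ) a b c v n =
      val q (leaf q (σ : ℝ) (τ : ℝ) ((w s(c, v j₀) : unitInterval) : ℝ) *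
        ∏ j ∈ (Finset.range n).erase j₀, leafOf q w a b c (v j)) := by
  obtain ⟨nab, nac, nbc⟩ := pairs_at_leaf_ne hab hac hbc hva hvb hj₀
  have hmem : j₀ ∈ Finset.range n := Finset.mem_range.2 hj₀
  rw [transfer3, zvec_eq_prod, ← Finset.mul_prod_erase _ _ hmem]
  congr 1
  congr 1
  · simp only [leafOf, Function.update_self, Function.update_of_ne nab, Function.update_of_ne nbc.symm,
      Function.update_of_ne nac.symm]
  · refine Finset.prod_congr rfl fun j hj => ?_
    have hj' : j ≠ j₀ ∧ j < n := by simpa [Finset.mem_erase, Finset.mem_range] using hj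
    rw [leafOf_update_of_ne hinj hva hvb hvc q _ b hj₀ hj'.2 hj'.1 τ, leafOf_update_of_ne hinj hva hvb hvc q w a hj₀ hj'.2 hj'.1 σ]

omit [Fintype V] hab hac hbc hinj hva hvb hvc in
/-- The product of the other leaf letters lies in the monoid. [folklore] -/
theorem inK_prod_erase (q : ℝ) (w : Sym2 V → unitInterval) (j₀ : ℕ) :
    InK q (∏ j ∈ (Finset.range n).erase j₀, leafOf q w a b c (v j)) :=
  inK_prod _ _ fun j _ => isLetter_leafOf q w a b c (v j)

/-! ### THEOREM T1 (measure level) -/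

/-- **T1 — the two edges `s(a, u)`, `s(b, u)` at a leaf `u = v j₀` of the weighted `K_{3,n}` are negatively correlated under `φ_{w,q}`,
`0 < q ≤ 1`, for every `n` and all weights.** (transcription of bschramm/prim-bschramm-fk-3/THREE-APEX.md §4, §6) -/
theorem negCorr_leaf_ab {q : ℝ} (hq0 : 0 < q) (hq1 : q ≤ 1) (hcard : Fintype.card V = n + 3) (w : Sym2 V → unitInterval)
    (hsupp : ∀ e, e ∉ apexPairs a b c v n → w e = 0) {j₀ : ℕ} (hj₀ : j₀ < n) :
    (rcMeasureW w q ∅).real ({ω : BondConfig V | s(a, v j₀) ∈ ω} ∩ {ω | s(b, v j₀) ∈ ω}) ≤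
      (rcMeasureW w q ∅).real {ω : BondConfig V | s(a, v j₀) ∈ ω} * (rcMeasureW w q ∅).real {ω : BondConfig V | s(b, v j₀) ∈ ω} := by
  obtain ⟨nab, nac, nbc⟩ := pairs_at_leaf_ne hab hac hbc hva hvb hj₀
  obtain ⟨hea, heb⟩ := mem_apexPairs_ab (a := a) (b := b) (c := c) (v := v) hj₀
  have hfe : s(b, v j₀) ≠ s(a, v j₀) := nab.symm
  -- supports of the re-pinned weight vectors
  have hsupp1 : ∀ σ τ : unitInterval, ∀ g, g ∉ apexPairs a b c v n →
      Function.update (Function.update w s(a, v j₀) σ) s(b, v j₀) τ g = 0 :=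
    fun σ τ => supp_update_apexPair _ (supp_update_apexPair w hsupp hea σ) heb τ
  -- the four partition functions through the letter product
  have hZ : ∀ σ τ : unitInterval,
      rcPartitionFunctionW (Function.update (Function.update w s(a, v j₀) σ) s(b, v j₀) τ) q ∅ =
        val q (leaf q (σ : ℝ) (τ : ℝ) ((w s(c, v j₀) : unitInterval) : ℝ) * ∏ j ∈ (Finset.range n).erase j₀, leafOf q w a b c (v j)) := by
    intro σ τ
    rw [rcPartitionFunctionW_eq_transfer3 hab hac hbc hinj hva hvb hvc hcard q _ (hsupp1 σ τ)]
    exact transfer3_pin_leaf hab hac hbc hinj hva hvb hvc q w hj₀ σ τ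
  have hR := inK_prod_erase (a := a) (b := b) (c := c) (v := v) (n := n) q w j₀
  generalize hRdef : ∏ j ∈ (Finset.range n).erase j₀, leafOf q w a b c (v j) = R at hZ hR
  -- weights of the two edges and of the third edge at the leaf
  have hs0 : 0 ≤ ((w s(a, v j₀) : unitInterval) : ℝ) := (w _).2.1
  have hs1 : ((w s(a, v j₀) : unitInterval) : ℝ) ≤ 1 := (w _).2.2
  have ht0 : 0 ≤ ((w s(b, v j₀) : unitInterval) : ℝ) := (w _).2.1
  have ht1 : ((w s(b, v j₀) : unitInterval) : ℝ) ≤ 1 := (w _).2.2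
  have hc0 : 0 ≤ ((w s(c, v j₀) : unitInterval) : ℝ) := (w _).2.1
  have hc1 : ((w s(c, v j₀) : unitInterval) : ℝ) ≤ 1 := (w _).2.2
  -- masses
  have hZw : rcPartitionFunctionW w q ∅ =
      rcPartitionFunctionW (Function.update (Function.update w s(a, v j₀) (w s(a, v j₀))) s(b, v j₀) (w s(b, v j₀))) q ∅ := by
    rw [Function.update_eq_self, Function.update_eq_self]
  have hSe : ∑ ω : BondConfig V, rcWeightW w q ∅ ω * ind {ω : BondConfig V | s(a, v j₀) ∈ ω} ω =
      ((w s(a, v j₀) : unitInterval) : ℝ) *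
        rcPartitionFunctionW (Function.update (Function.update w s(a, v j₀) 1) s(b, v j₀) (w s(b, v j₀))) q ∅ := by
    rw [Wheel.sum_openPair_eq_mul_Z w q s(a, v j₀)]
    congr 2
    conv_lhs => rw [← Function.update_eq_self s(b, v j₀) (Function.update w s(a, v j₀) 1)]
    rw [Function.update_of_ne hfe]
  have hSf : ∑ ω : BondConfig V, rcWeightW w q ∅ ω * ind {ω : BondConfig V | s(b, v j₀) ∈ ω} ω =
      ((w s(b, v j₀) : unitInterval) : ℝ) *
        rcPartitionFunctionW (Function.update (Function.update w s(a, v j₀) (w s(a, v j₀))) s(b, v j₀) 1) q ∅ := by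
    rw [Wheel.sum_openPair_eq_mul_Z w q s(b, v j₀), Function.update_eq_self]
  have hSef : ∑ ω : BondConfig V, rcWeightW w q ∅ ω * ind ({ω : BondConfig V | s(a, v j₀) ∈ ω} ∩ {ω | s(b, v j₀) ∈ ω}) ω =
      ((w s(a, v j₀) : unitInterval) : ℝ) * ((w s(b, v j₀) : unitInterval) : ℝ) *
        rcPartitionFunctionW (Function.update (Function.update w s(a, v j₀) 1) s(b, v j₀) 1) q ∅ :=
    Wheel.sum_openPair_inter_openPair_eq w q hfe
  -- the Rayleigh inequality on the monoid
  have hT1 : 0 ≤ t1Form q ((w s(c, v j₀) : unitInterval) : ℝ) R := hR.t1Form_nonneg hq0.le hq1 hc0 hc1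
  have hnn : 0 ≤ ((w s(a, v j₀) : unitInterval) : ℝ) * ((w s(b, v j₀) : unitInterval) : ℝ) *
      ((1 - ((w s(a, v j₀) : unitInterval) : ℝ)) * (1 - ((w s(b, v j₀) : unitInterval) : ℝ))) *
        t1Form q ((w s(c, v j₀) : unitInterval) : ℝ) R :=
    mul_nonneg (mul_nonneg (mul_nonneg hs0 ht0) (mul_nonneg (sub_nonneg.2 hs1) (sub_nonneg.2 ht1))) hT1
  -- the main inequality between masses: `S(J_e ∩ J_f)·Z ≤ S(J_e)·S(J_f)`
  have main : (∑ ω : BondConfig V, rcWeightW w q ∅ ω * ind ({ω : BondConfig V | s(a, v j₀) ∈ ω} ∩ {ω | s(b, v j₀) ∈ ω}) ω) *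
      rcPartitionFunctionW w q ∅ ≤
      (∑ ω : BondConfig V, rcWeightW w q ∅ ω * ind {ω : BondConfig V | s(a, v j₀) ∈ ω} ω) *
        ∑ ω : BondConfig V, rcWeightW w q ∅ ω * ind {ω : BondConfig V | s(b, v j₀) ∈ ω} ω := by
    rw [hSef, hSe, hSf, hZw, hZ, hZ, hZ, hZ, Set.Icc.coe_one]
    have k := rayleigh_T1_prob q ((w s(a, v j₀) : unitInterval) : ℝ) ((w s(b, v j₀) : unitInterval) : ℝ)
      ((w s(c, v j₀) : unitInterval) : ℝ) R
    nlinarith [k, hnn]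
  -- to probabilities
  have hZpos := rcPartitionFunctionW_pos w hq0 (∅ : Set V)
  rw [rcMeasureW_real_eq_sum_div w hq0, rcMeasureW_real_eq_sum_div w hq0, rcMeasureW_real_eq_sum_div w hq0, div_mul_div_comm,
    div_le_div_iff₀ hZpos (mul_pos hZpos hZpos)]
  nlinarith [mul_le_mul_of_nonneg_right main hZpos.le]

end Setting

/-! ### All three pairs at a leaf; the `NegCorrPairSupp` slices -/

section AllPairs

variable {a b c : V} {v : ℕ → V} {n : ℕ}
variable (hab : a ≠ b) (hac : a ≠ c) (hbc : b ≠ c) (hinj : ∀ j k, j < n → k < n → v j = v k → j = k)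
  (hva : ∀ j, j < n → v j ≠ a) (hvb : ∀ j, j < n → v j ≠ b) (hvc : ∀ j, j < n → v j ≠ c)
include hab hac hbc hinj hva hvb hvc

/-- T1 for the pair `s(a, u)`, `s(c, u)`. (transcription of bschramm/prim-bschramm-fk-3/THREE-APEX.md §4, §6) -/
theorem negCorr_leaf_ac {q : ℝ} (hq0 : 0 < q) (hq1 : q ≤ 1) (hcard : Fintype.card V = n + 3) (w : Sym2 V → unitInterval)
    (hsupp : ∀ e, e ∉ apexPairs a b c v n → w e = 0) {j₀ : ℕ} (hj₀ : j₀ < n) :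
    (rcMeasureW w q ∅).real ({ω : BondConfig V | s(a, v j₀) ∈ ω} ∩ {ω | s(c, v j₀) ∈ ω}) ≤
      (rcMeasureW w q ∅).real {ω : BondConfig V | s(a, v j₀) ∈ ω} * (rcMeasureW w q ∅).real {ω : BondConfig V | s(c, v j₀) ∈ ω} := by
  have hsupp' : ∀ e, e ∉ apexPairs a c b v n → w e = 0 := by rw [apexPairs_swap₂₃]; exact hsupp
  exact negCorr_leaf_ab hac hab hbc.symm hinj hva hvc hvb hq0 hq1 hcard w hsupp' hj₀

/-- T1 for the pair `s(b, u)`, `s(c, u)`. (transcription of bschramm/prim-bschramm-fk-3/THREE-APEX.md §4, §6) -/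
theorem negCorr_leaf_bc {q : ℝ} (hq0 : 0 < q) (hq1 : q ≤ 1) (hcard : Fintype.card V = n + 3) (w : Sym2 V → unitInterval)
    (hsupp : ∀ e, e ∉ apexPairs a b c v n → w e = 0) {j₀ : ℕ} (hj₀ : j₀ < n) :
    (rcMeasureW w q ∅).real ({ω : BondConfig V | s(b, v j₀) ∈ ω} ∩ {ω | s(c, v j₀) ∈ ω}) ≤
      (rcMeasureW w q ∅).real {ω : BondConfig V | s(b, v j₀) ∈ ω} * (rcMeasureW w q ∅).real {ω : BondConfig V | s(c, v j₀) ∈ ω} := by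
  have hsupp' : ∀ e, e ∉ apexPairs b c a v n → w e = 0 := by rw [apexPairs_rotate]; exact hsupp
  exact negCorr_leaf_ab hbc hab.symm hac.symm hinj hvb hvc hva hq0 hq1 hcard w hsupp' hj₀

/-- **T1 — every pair of edges at a common leaf of `K_{3,n}` is negatively correlated under every `φ_{w,q}` supported on `K_{3,n}`,
`0 < q ≤ 1`** (`x ≠ y` apices, `u = v j₀`). (transcription of bschramm/prim-bschramm-fk-3/THREE-APEX.md §4, §6) -/
theorem negCorr_leaf {q : ℝ} (hq0 : 0 < q) (hq1 : q ≤ 1) (hcard : Fintype.card V = n + 3) (w : Sym2 V → unitInterval)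
    (hsupp : ∀ e, e ∉ apexPairs a b c v n → w e = 0) {j₀ : ℕ} (hj₀ : j₀ < n) {x y : V} (hx : x = a ∨ x = b ∨ x = c)
    (hy : y = a ∨ y = b ∨ y = c) (hxy : x ≠ y) :
    (rcMeasureW w q ∅).real ({ω : BondConfig V | s(x, v j₀) ∈ ω} ∩ {ω | s(y, v j₀) ∈ ω}) ≤
      (rcMeasureW w q ∅).real {ω : BondConfig V | s(x, v j₀) ∈ ω} * (rcMeasureW w q ∅).real {ω : BondConfig V | s(y, v j₀) ∈ ω} := by
  have hab' := negCorr_leaf_ab hab hac hbc hinj hva hvb hvc hq0 hq1 hcard w hsupp hj₀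
  have hac' := negCorr_leaf_ac hab hac hbc hinj hva hvb hvc hq0 hq1 hcard w hsupp hj₀
  have hbc' := negCorr_leaf_bc hab hac hbc hinj hva hvb hvc hq0 hq1 hcard w hsupp hj₀
  rcases hx with rfl | rfl | rfl <;> rcases hy with rfl | rfl | rfl
  · exact absurd rfl hxy
  · exact hab'
  · exact hac'
  · rw [Set.inter_comm, mul_comm]; exact hab'
  · exact absurd rfl hxy
  · exact hbc'
  · rw [Set.inter_comm, mul_comm]; exact hac'
  · rw [Set.inter_comm, mul_comm]; exact hbc'
  · exact absurd rfl hxy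

/-- **`NegCorrPairSupp` slice**: the pair `(s(x, u), s(y, u))` at a leaf is negatively correlated under every `φ_{w,q}` supported on the pairs of
`K_{3,n}`, `0 < q ≤ 1`. (transcription of bschramm/prim-bschramm-fk-3/THREE-APEX.md §4, §6) -/
theorem negCorrPairSupp_leaf {q : ℝ} (hq0 : 0 < q) (hq1 : q ≤ 1) (hcard : Fintype.card V = n + 3) {j₀ : ℕ} (hj₀ : j₀ < n) {x y : V}
    (hx : x = a ∨ x = b ∨ x = c) (hy : y = a ∨ y = b ∨ y = c) (hxy : x ≠ y) :
    NegCorrPairSupp (↑(apexPairs a b c v n) : Set (Sym2 V)) q s(x, v j₀) s(y, v j₀) := by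
  intro w hw
  have hsupp : ∀ e, e ∉ apexPairs a b c v n → w e = 0 := by
    intro e he
    by_contra h
    have h' : ((w e : unitInterval) : ℝ) ≠ 0 := fun h0 => h (Subtype.ext h0)
    exact he (Finset.mem_coe.1 (hw e h'))
  exact negCorr_leaf hab hac hbc hinj hva hvb hvc hq0 hq1 hcard w hsupp hj₀ hx hy hxy

end AllPairs

end ThreeApex

end FK

end Summit.CriticalPhenomena.PercolationContinuityZ3.Theorems

end
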